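import Literature.Analysis.ValidatedNumerics.IntervalPolynomial
import HarnessLib

/-!
# Taylor models in one parameter over the interval polynomials `IPoly`

Trunk T-ANA (Analysis/ValidatedNumerics); namespace `Literature.Analysis.ValidatedNumerics.PolyMP`.
Sequel of `IntervalPolynomial.lean`. When a validated computation depends on a parameter ranging
over a box `r = r_c + ρ`, `|ρ| ≤ h`, plain interval arithmetic in `ρ` loses the correlations between
intermediate quantities (the dependency problem); **Taylor models** (Berz–Makino) keep a polynomial
in `ρ` with interval coefficients instead. Here a function `f` of `ρ` is represented by an interval
polynomial `P = [P₀, …, P_D]` with the meaning (`TMem S h f P`) that for every `|ρ| ≤ h` there are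
reals `aᵢ ∈ Pᵢ` with `f(ρ) = Σ aᵢ ρⁱ` (the remainder lives in the coefficients, typically `P₀`).
Contents: the semantics `TMem`; sound operations `tconst`, `tvar`, `taddI`, `tnegI`, `tsubI`,
`tsmulInt`, `tdivNat`, `tsmulI`, `ttruncI` (degree truncation with the tail folded into `P₀`),
`tmulI`; range bounds `tupperI`, `tlowerI`, `tabsI`; and two *verification* rules replacing
division and square root — the user supplies an approximate inverse (resp. square root) `Q` and a
scaled error `e`, and `checkInv` (resp. `checkSqrt`) validates `|1/g − Q| ≤ e/S` (resp.
`|√g − Q| ≤ e/S`) by multiplication only (`tmem_inv_of_check`, `tmem_sqrt_of_check`). Motivated by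
parameter-dependent barrier certificates such as Buckmaster–Cao-Labora–Gómez-Serrano, App. B (who
meet the same dependency problem in their parameter `r`), but problem-independent. No facts, no
axioms.

## References

* K. Makino, M. Berz, *Taylor models and other validated functional inclusion methods*,
  Int. J. Pure Appl. Math. 4 (2003), 379–456. [folklore]
* T. Buckmaster, G. Cao-Labora, J. Gómez-Serrano, *Smooth imploding solutions for 3D compressible
  fluids*, Forum Math. Pi 13 (2025) e6, Appendix B. [cite: BuckmasterCaolaboraGomezserrano2025, Appendix B]
-/

namespace Literature.Analysis.ValidatedNumerics

namespace PolyMP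

open Literature.Analysis.ValidatedNumerics.NumericsMP

/-! ### Semantics -/

/-- Taylor-model membership: on `|ρ| ≤ h`, `f(ρ) = Σ aᵢ ρⁱ` for some `aᵢ ∈ Pᵢ` (depending on `ρ`).
[folklore] -/
def TMem (S : ℕ) (h : ℚ) (f : ℝ → ℝ) (P : IPoly) : Prop :=
  ∀ ρ : ℝ, |ρ| ≤ h → ∃ as : List ℝ, PMem S as P ∧ f ρ = evalR as ρ

/-- A constant. [folklore] -/
def tconst (I : MI) : IPoly := [I]

/-- [folklore] -/
theorem tmem_const {S : ℕ} {h : ℚ} {x : ℝ} {I : MI} (hx : MI.mem S x I) :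
    TMem S h (fun _ => x) (tconst I) := fun ρ _ =>
  ⟨[x], pmem_cons hx (pmem_nil S), by simp⟩

/-- The variable `ρ ↦ c + ρ`. [folklore] -/
def tvar (S : ℕ) (c : MI) : IPoly := [c, MI.ofInt S 1]

/-- [folklore] -/
theorem tmem_var {S : ℕ} {h : ℚ} {c : ℝ} {C : MI} (hc : MI.mem S c C) :
    TMem S h (fun ρ => c + ρ) (tvar S C) := fun ρ _ =>
  ⟨[c, 1], pmem_cons hc (pmem_cons (by simpa using MI.mem_ofInt S 1) (pmem_nil S)), by simp⟩

/-- Sum. [folklore] -/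
def taddI (P Q : IPoly) : IPoly := addI P Q

/-- [folklore] -/
theorem tmem_add {S : ℕ} {h : ℚ} {f g : ℝ → ℝ} {P Q : IPoly} (hf : TMem S h f P) (hg : TMem S h g Q) :
    TMem S h (fun ρ => f ρ + g ρ) (taddI P Q) := fun ρ hρ => by
  obtain ⟨as, has, ef⟩ := hf ρ hρ
  obtain ⟨bs, hbs, eg⟩ := hg ρ hρ
  exact ⟨addR as bs, pmem_addI has hbs, by simp only [evalR_addR, ef, eg]⟩

/-- Negation. [folklore] -/
def tnegI (P : IPoly) : IPoly := P.map MI.neg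

/-- [folklore] -/
theorem tmem_neg {S : ℕ} {h : ℚ} {f : ℝ → ℝ} {P : IPoly} (hf : TMem S h f P) :
    TMem S h (fun ρ => -f ρ) (tnegI P) := fun ρ hρ => by
  obtain ⟨as, has, ef⟩ := hf ρ hρ
  exact ⟨as.map Neg.neg, pmem_neg has, by simp only [evalR_map_neg, ef]⟩

/-- Difference. [folklore] -/
def tsubI (P Q : IPoly) : IPoly := taddI P (tnegI Q)

/-- [folklore] -/
theorem tmem_sub {S : ℕ} {h : ℚ} {f g : ℝ → ℝ} {P Q : IPoly} (hf : TMem S h f P) (hg : TMem S h g Q) :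
    TMem S h (fun ρ => f ρ - g ρ) (tsubI P Q) := by
  have := tmem_add hf (tmem_neg hg)
  simpa [sub_eq_add_neg, tsubI] using this

/-- Product with an integer. [folklore] -/
def tsmulInt (k : ℤ) (P : IPoly) : IPoly := smulIntI k P

/-- [folklore] -/
theorem tmem_smulInt {S : ℕ} {h : ℚ} {f : ℝ → ℝ} {P : IPoly} (k : ℤ) (hf : TMem S h f P) :
    TMem S h (fun ρ => (k : ℝ) * f ρ) (tsmulInt k P) := fun ρ hρ => by
  obtain ⟨as, has, ef⟩ := hf ρ hρ
  exact ⟨smulR (k : ℝ) as, pmem_smulIntI k has, by simp only [evalR_smulR, ef]⟩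

/-- Division by a positive natural number. [folklore] -/
def tdivNat (n : ℕ) (P : IPoly) : IPoly := sdivNatI n P

/-- [folklore] -/
theorem tmem_divNat {S : ℕ} {h : ℚ} {f : ℝ → ℝ} {P : IPoly} {n : ℕ} (hn : 0 < n) (hf : TMem S h f P) :
    TMem S h (fun ρ => f ρ / n) (tdivNat n P) := fun ρ hρ => by
  obtain ⟨as, has, ef⟩ := hf ρ hρ
  refine ⟨smulR ((n : ℝ)⁻¹) as, pmem_sdivNatI hn has, ?_⟩
  simp only [evalR_smulR, ef, div_eq_inv_mul]

/-- Product with an interval constant. [folklore] -/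
def tsmulI (S : ℕ) (c : MI) (P : IPoly) : IPoly := smulI S c P

/-- [folklore] -/
theorem tmem_smulI {S : ℕ} (hS : 0 < S) {h : ℚ} {c : ℝ} {C : MI} (hc : MI.mem S c C) {f : ℝ → ℝ}
    {P : IPoly} (hf : TMem S h f P) : TMem S h (fun ρ => c * f ρ) (tsmulI S C P) := fun ρ hρ => by
  obtain ⟨as, has, ef⟩ := hf ρ hρ
  exact ⟨smulR c as, pmem_smulI hS hc has, by simp only [evalR_smulR, ef]⟩

/-! ### Truncation -/

/-- Evaluation splits at any index: `p(x) = (take n p)(x) + xⁿ · (drop n p)(x)`. [folklore] -/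
theorem evalR_take_add_drop : ∀ (n : ℕ) (as : List ℝ) (x : ℝ),
    evalR as x = evalR (as.take n) x + x ^ n * evalR (as.drop n) x
  | 0, as, x => by simp
  | n + 1, [], x => by simp
  | n + 1, a :: as, x => by
      simp only [List.take_succ_cons, List.drop_succ_cons, evalR_cons, evalR_take_add_drop n as x]
      ring

/-- [folklore] -/
theorem pmem_take {S : ℕ} : ∀ (n : ℕ) {as : List ℝ} {P : IPoly}, PMem S as P →
    PMem S (as.take n) (P.take n)
  | 0, _, _, _ => by simpa using pmem_nil S
  | n + 1, _, _, List.Forall₂.nil => by simpa using pmem_nil S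
  | n + 1, _, _, List.Forall₂.cons ha hP => by
      simp only [List.take_succ_cons]; exact pmem_cons ha (pmem_take n hP)

/-- [folklore] -/
theorem pmem_drop {S : ℕ} : ∀ (n : ℕ) {as : List ℝ} {P : IPoly}, PMem S as P →
    PMem S (as.drop n) (P.drop n)
  | 0, _, _, h => by simpa using h
  | n + 1, _, _, List.Forall₂.nil => by simpa using pmem_nil S
  | n + 1, _, _, List.Forall₂.cons ha hP => by
      simp only [List.drop_succ_cons]; exact pmem_drop n hP

/-- Scaled integer bound of `h^n · absBound(tail, h)` for the tail folded into the constant term.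
[folklore] -/
def tailBoundI (S : ℕ) (h : ℚ) (n : ℕ) (T : IPoly) : ℤ :=
  let hn : ℚ := h ^ n
  Numerics.cdiv (hn.num * absBoundI S h.num h.den T) hn.den

/-- [folklore] -/
theorem tail_le_tailBoundI {S : ℕ} {h : ℚ} (h0 : 0 ≤ h) (n : ℕ) {as : List ℝ} {T : IPoly}
    (has : PMem S as T) {ρ : ℝ} (hρ : |ρ| ≤ h) :
    |ρ ^ n * evalR as ρ| * S ≤ (tailBoundI S h n T : ℝ) := by
  unfold tailBoundI
  set hn : ℚ := h ^ n with hhn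
  have hn0 : 0 ≤ hn := by rw [hhn]; positivity
  have hnum0 : 0 ≤ hn.num := Rat.num_nonneg.mpr hn0
  have hB := absBoundR_le_absBoundI (S := S) (Rat.num_nonneg.mpr h0) h.pos has
  rw [← ratCast_eq_num_div_den] at hB
  have htl := abs_evalR_le_absBoundR as hρ
  have hdz : (0 : ℤ) < hn.den := by exact_mod_cast hn.pos
  have hcd := Numerics.le_cdiv_mul_real (a := hn.num * absBoundI S h.num h.den T) hdz
  have hdR : (0 : ℝ) < hn.den := by exact_mod_cast hn.pos
  have hnR : ((hn : ℚ) : ℝ) = (hn.num : ℝ) / hn.den := ratCast_eq_num_div_den hn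
  have hpow : |ρ ^ n| ≤ ((hn : ℚ) : ℝ) := by
    rw [abs_pow, hhn]; push_cast; exact pow_le_pow_left₀ (abs_nonneg ρ) hρ n
  have hS0 : (0 : ℝ) ≤ S := by positivity
  have h1 : |ρ ^ n * evalR as ρ| * S ≤ ((hn : ℚ) : ℝ) * (absBoundR as ((h:ℚ):ℝ) * S) := by
    rw [abs_mul]
    have hbn : 0 ≤ absBoundR as ((h : ℚ) : ℝ) := absBoundR_nonneg as (by exact_mod_cast h0)
    calc |ρ ^ n| * |evalR as ρ| * S ≤ ((hn : ℚ) : ℝ) * absBoundR as ((h:ℚ):ℝ) * S := by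
          gcongr
      _ = _ := by ring
  have h2 : ((hn : ℚ) : ℝ) * (absBoundR as ((h:ℚ):ℝ) * S) ≤ ((hn : ℚ) : ℝ) * (absBoundI S h.num h.den T : ℝ) :=
    mul_le_mul_of_nonneg_left hB (by exact_mod_cast hn0)
  have h3 : ((hn.num * absBoundI S h.num h.den T : ℤ) : ℝ) ≤
      ((Numerics.cdiv (hn.num * absBoundI S h.num h.den T) hn.den : ℤ) : ℝ) * hn.den := by exact_mod_cast hcd
  push_cast at h3
  have h4 : ((hn : ℚ) : ℝ) * (absBoundI S h.num h.den T : ℝ) ≤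
      ((Numerics.cdiv (hn.num * absBoundI S h.num h.den T) hn.den : ℤ) : ℝ) := by
    rw [hnR, div_mul_eq_mul_div, div_le_iff₀ hdR]; linarith
  linarith

/-- Widen the constant coefficient of an interval polynomial. [folklore] -/
def widen0 (P : IPoly) (e : ℤ) : IPoly :=
  match P with
  | [] => [⟨-e, e⟩]
  | I :: Q => MI.widen I e :: Q

/-- Folding a small perturbation of the value into the constant coefficient. [folklore] -/
theorem exists_widen0 {S : ℕ} {as : List ℝ} {P : IPoly} (has : PMem S as P) {δ : ℝ} {e : ℤ}
    (hδ : |δ| * S ≤ e) (x : ℝ) :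
    ∃ bs : List ℝ, PMem S bs (widen0 P e) ∧ evalR bs x = evalR as x + δ := by
  match as, P, has with
  | [], [], _ =>
    refine ⟨[δ], pmem_cons ?_ (pmem_nil S), by simp⟩
    simp only [MI.mem, Int.cast_neg]
    have hS0 : (0 : ℝ) ≤ S := by positivity
    have e1 : |δ| * S = |δ * S| := by rw [abs_mul, abs_of_nonneg hS0]
    rw [e1] at hδ
    constructor <;> linarith [(abs_le.1 hδ).1, (abs_le.1 hδ).2]
  | a :: as, I :: P, List.Forall₂.cons ha hP =>
    refine ⟨(a + δ) :: as, pmem_cons ?_ hP, by simp; ring⟩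
    exact MI.mem_widen ha (by simpa using hδ)

/-- Degree truncation: keep the coefficients of `ρ⁰ … ρ^D`, fold the rest into `P₀`. [folklore] -/
def ttruncI (S : ℕ) (h : ℚ) (D : ℕ) (P : IPoly) : IPoly :=
  widen0 (P.take (D + 1)) (tailBoundI S h (D + 1) (P.drop (D + 1)))

/-- [folklore] -/
theorem tmem_trunc {S : ℕ} {h : ℚ} (h0 : 0 ≤ h) (D : ℕ) {f : ℝ → ℝ} {P : IPoly} (hf : TMem S h f P) :
    TMem S h f (ttruncI S h D P) := fun ρ hρ => by
  obtain ⟨as, has, ef⟩ := hf ρ hρ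
  have hsplit := evalR_take_add_drop (D + 1) as ρ
  have htail := tail_le_tailBoundI h0 (D + 1) (pmem_drop (D + 1) has) hρ
  obtain ⟨bs, hbs, eb⟩ := exists_widen0 (pmem_take (D + 1) has) htail ρ
  exact ⟨bs, hbs, by rw [eb, ef, hsplit]⟩

/-- Truncated product. [folklore] -/
def tmulI (S : ℕ) (h : ℚ) (D : ℕ) (P Q : IPoly) : IPoly := ttruncI S h D (mulI S P Q)

/-- [folklore] -/
theorem tmem_mul {S : ℕ} (hS : 0 < S) {h : ℚ} (h0 : 0 ≤ h) (D : ℕ) {f g : ℝ → ℝ} {P Q : IPoly}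
    (hf : TMem S h f P) (hg : TMem S h g Q) : TMem S h (fun ρ => f ρ * g ρ) (tmulI S h D P Q) := by
  refine tmem_trunc h0 D fun ρ hρ => ?_
  obtain ⟨as, has, ef⟩ := hf ρ hρ
  obtain ⟨bs, hbs, eg⟩ := hg ρ hρ
  exact ⟨mulR as bs, pmem_mulI hS has hbs, by rw [evalR_mulR, ef, eg]⟩

/-! ### Range bounds -/

/-- Scaled upper bound of `f` on `|ρ| ≤ h`: `P₀.hi + h·absBound(tail)`. [folklore] -/
def tupperI (S : ℕ) (h : ℚ) (P : IPoly) : ℤ :=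
  match P with
  | [] => 0
  | I :: T => I.hi + tailBoundI S h 1 T

/-- Scaled lower bound of `f` on `|ρ| ≤ h`. [folklore] -/
def tlowerI (S : ℕ) (h : ℚ) (P : IPoly) : ℤ :=
  match P with
  | [] => 0
  | I :: T => I.lo - tailBoundI S h 1 T

/-- [folklore] -/
theorem le_tupperI {S : ℕ} {h : ℚ} (h0 : 0 ≤ h) {f : ℝ → ℝ} {P : IPoly} (hf : TMem S h f P)
    {ρ : ℝ} (hρ : |ρ| ≤ h) : f ρ * S ≤ (tupperI S h P : ℝ) := by
  obtain ⟨as, has, ef⟩ := hf ρ hρ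
  match as, P, has with
  | [], [], _ => simp [tupperI, ef]
  | a :: as, I :: T, List.Forall₂.cons ha hT =>
    simp only [tupperI, Int.cast_add, ef, evalR_cons]
    have h1 := tail_le_tailBoundI h0 1 hT hρ
    rw [pow_one] at h1
    have h2' : ρ * evalR as ρ * S ≤ (tailBoundI S h 1 T : ℝ) := by
      have := le_abs_self (ρ * evalR as ρ)
      have hS0 : (0 : ℝ) ≤ S := by positivity
      nlinarith
    nlinarith [ha.2]

/-- [folklore] -/
theorem tlowerI_le {S : ℕ} {h : ℚ} (h0 : 0 ≤ h) {f : ℝ → ℝ} {P : IPoly} (hf : TMem S h f P)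
    {ρ : ℝ} (hρ : |ρ| ≤ h) : (tlowerI S h P : ℝ) ≤ f ρ * S := by
  obtain ⟨as, has, ef⟩ := hf ρ hρ
  match as, P, has with
  | [], [], _ => simp [tlowerI, ef]
  | a :: as, I :: T, List.Forall₂.cons ha hT =>
    simp only [tlowerI, Int.cast_sub, ef, evalR_cons]
    have h1 := tail_le_tailBoundI h0 1 hT hρ
    rw [pow_one] at h1
    have h2' : -(ρ * evalR as ρ * S) ≤ (tailBoundI S h 1 T : ℝ) := by
      have := neg_abs_le (ρ * evalR as ρ)
      have hS0 : (0 : ℝ) ≤ S := by positivity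
      nlinarith
    nlinarith [ha.1]

/-- Scaled upper bound of `|f|` on `|ρ| ≤ h`. [folklore] -/
def tabsI (S : ℕ) (h : ℚ) (P : IPoly) : ℤ := max (tupperI S h P) (-tlowerI S h P)

/-- [folklore] -/
theorem abs_le_tabsI {S : ℕ} {h : ℚ} (h0 : 0 ≤ h) {f : ℝ → ℝ} {P : IPoly} (hf : TMem S h f P)
    {ρ : ℝ} (hρ : |ρ| ≤ h) : |f ρ| * S ≤ (tabsI S h P : ℝ) := by
  have h1 := le_tupperI h0 hf hρ
  have h2 := tlowerI_le h0 hf hρ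
  simp only [tabsI, Int.cast_max, Int.cast_neg]
  have hS0 : (0 : ℝ) ≤ S := by positivity
  rw [← abs_of_nonneg hS0, ← abs_mul]
  rcases le_total 0 (f ρ * S) with hp | hn
  · rw [abs_of_nonneg hp]; exact le_max_of_le_left h1
  · rw [abs_of_nonpos hn]; exact le_max_of_le_right (by linarith)

/-! ### Verified inverse and square root -/

/-- The thin interval of the integer `1`. [folklore] -/
private def oneI (S : ℕ) : IPoly := [MI.ofInt S 1]

/-- Check that `Q` is an inverse of (the function enclosed by) `G` up to `e/S`:
`|g| ≥ m/S > 0` and `|1 − g·Q| ≤ B/S` with `B · S ≤ e · m`. [folklore] -/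
def checkInv (S : ℕ) (h : ℚ) (D : ℕ) (G Q : IPoly) (e : ℕ) : Bool :=
  let m : ℤ := max (tlowerI S h G) (-tupperI S h G)
  let R : IPoly := tsubI (oneI S) (tmulI S h D G Q)
  let B : ℤ := tabsI S h R
  decide (0 < m) && decide (B * S ≤ e * m)

/-- **Verified division.** If `checkInv` accepts, `Q` widened by `e` in its constant coefficient
encloses `1/g`. [folklore] -/
theorem tmem_inv_of_check {S : ℕ} (hS : 0 < S) {h : ℚ} (h0 : 0 ≤ h) {D : ℕ} {g q : ℝ → ℝ}
    {G Q : IPoly} (hg : TMem S h g G) (hq : TMem S h q Q) {e : ℕ}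
    (hc : checkInv S h D G Q e = true) : TMem S h (fun ρ => (g ρ)⁻¹) (widen0 Q e) := by
  unfold checkInv at hc
  simp only [Bool.and_eq_true, decide_eq_true_eq] at hc
  obtain ⟨hm, hB⟩ := hc
  set m : ℤ := max (tlowerI S h G) (-tupperI S h G) with hmdef
  intro ρ hρ
  have hSr : (0 : ℝ) < S := by exact_mod_cast hS
  -- `|g ρ| * S ≥ m`
  have hgm : (m : ℝ) ≤ |g ρ| * S := by
    simp only [hmdef, Int.cast_max, Int.cast_neg]
    rcases le_total 0 (g ρ) with hp | hn
    · rw [abs_of_nonneg hp]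
      refine max_le (tlowerI_le h0 hg hρ) ?_
      have := le_tupperI h0 hg hρ
      nlinarith
    · rw [abs_of_nonpos hn]
      refine max_le ?_ ?_
      · have := tlowerI_le h0 hg hρ; nlinarith
      · have := le_tupperI h0 hg hρ; nlinarith
  have hmR : (0 : ℝ) < m := by exact_mod_cast hm
  have hgpos : 0 < |g ρ| := by
    by_contra hcon; push Not at hcon
    have : |g ρ| = 0 := le_antisymm hcon (abs_nonneg _)
    rw [this, zero_mul] at hgm; linarith
  have hg0 : g ρ ≠ 0 := abs_pos.mp hgpos
  -- the residual `1 - g q`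
  have h1 : TMem S h (fun _ => (1 : ℝ)) (oneI S) := by
    simpa [oneI, tconst] using tmem_const (S := S) (h := h) (x := (1:ℝ)) (by simpa using MI.mem_ofInt S 1)
  have hres : TMem S h (fun ρ => 1 - g ρ * q ρ) (tsubI (oneI S) (tmulI S h D G Q)) :=
    tmem_sub h1 (tmem_mul hS h0 D hg hq)
  have hRB := abs_le_tabsI h0 hres hρ
  set B : ℤ := tabsI S h (tsubI (oneI S) (tmulI S h D G Q)) with hBdef
  have hBR : ((B : ℤ) : ℝ) * S ≤ (e : ℝ) * m := by exact_mod_cast hB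
  -- `|1/g - q| = |1 - g q| / |g| ≤ (B/S) / (m/S) = B/m ≤ e/S`
  obtain ⟨as, has, eq⟩ := hq ρ hρ
  have hδ : |((g ρ)⁻¹ - q ρ)| * S ≤ e := by
    have e1 : (g ρ)⁻¹ - q ρ = (1 - g ρ * q ρ) / g ρ := by field_simp
    rw [e1, abs_div, div_mul_eq_mul_div, div_le_iff₀ hgpos]
    have hB' : (B : ℝ) ≤ (e : ℝ) * m / S := by rw [le_div_iff₀ hSr]; exact hBR
    have hm' : (e : ℝ) * m / S ≤ (e : ℝ) * |g ρ| := by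
      rw [div_le_iff₀ hSr]
      have he0 : (0 : ℝ) ≤ e := by positivity
      nlinarith
    linarith
  obtain ⟨bs, hbs, eb⟩ := exists_widen0 has (δ := (g ρ)⁻¹ - q ρ) (e := e) hδ ρ
  exact ⟨bs, hbs, by rw [eb, ← eq]; ring⟩

/-- Check that `Q ≥ 0` is a square root of (the function enclosed by) `G` up to `e/S`:
`q ≥ s/S > 0` and `|g − q²| ≤ B/S` with `B · S ≤ e · s`. [folklore] -/
def checkSqrt (S : ℕ) (h : ℚ) (D : ℕ) (G Q : IPoly) (e : ℕ) : Bool :=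
  let s : ℤ := tlowerI S h Q
  let R : IPoly := tsubI G (tmulI S h D Q Q)
  let B : ℤ := tabsI S h R
  decide (0 < s) && decide (0 ≤ tlowerI S h G) && decide (B * S ≤ e * s)

/-- **Verified square root.** If `checkSqrt` accepts, `Q` widened by `e` encloses `√g`. [folklore] -/
theorem tmem_sqrt_of_check {S : ℕ} (hS : 0 < S) {h : ℚ} (h0 : 0 ≤ h) {D : ℕ} {g q : ℝ → ℝ}
    {G Q : IPoly} (hg : TMem S h g G) (hq : TMem S h q Q) {e : ℕ}
    (hc : checkSqrt S h D G Q e = true) : TMem S h (fun ρ => Real.sqrt (g ρ)) (widen0 Q e) := by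
  unfold checkSqrt at hc
  simp only [Bool.and_eq_true, decide_eq_true_eq] at hc
  obtain ⟨⟨hs, hG0⟩, hB⟩ := hc
  intro ρ hρ
  have hSr : (0 : ℝ) < S := by exact_mod_cast hS
  have hqs : ((tlowerI S h Q : ℤ) : ℝ) ≤ q ρ * S := tlowerI_le h0 hq hρ
  have hsR : (0 : ℝ) < (tlowerI S h Q : ℤ) := by exact_mod_cast hs
  have hqpos : 0 < q ρ := by nlinarith
  have hgnn : 0 ≤ g ρ := by
    have := tlowerI_le h0 hg hρ
    have hG0' : (0 : ℝ) ≤ (tlowerI S h G : ℤ) := by exact_mod_cast hG0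
    nlinarith
  have hres : TMem S h (fun ρ => g ρ - q ρ * q ρ) (tsubI G (tmulI S h D Q Q)) :=
    tmem_sub hg (tmem_mul hS h0 D hq hq)
  have hRB := abs_le_tabsI h0 hres hρ
  set B : ℤ := tabsI S h (tsubI G (tmulI S h D Q Q)) with hBdef
  have hBR : ((B : ℤ) : ℝ) * S ≤ (e : ℝ) * (tlowerI S h Q : ℤ) := by exact_mod_cast hB
  obtain ⟨as, has, eq⟩ := hq ρ hρ
  -- `|√g - q| = |g - q²| / (√g + q) ≤ |g - q²| / q`
  have hδ : |Real.sqrt (g ρ) - q ρ| * S ≤ e := by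
    have hsq : Real.sqrt (g ρ) ^ 2 = g ρ := Real.sq_sqrt hgnn
    have hsum : 0 < Real.sqrt (g ρ) + q ρ := by positivity
    have e1 : Real.sqrt (g ρ) - q ρ = (g ρ - q ρ * q ρ) / (Real.sqrt (g ρ) + q ρ) := by
      field_simp
      nlinarith [hsq]
    rw [e1, abs_div, abs_of_pos hsum, div_mul_eq_mul_div, div_le_iff₀ hsum]
    have h2 : |g ρ - q ρ * q ρ| * S ≤ (B : ℝ) := hRB
    -- `B ≤ e * s / S ≤ e * q ≤ e * (√g + q)`
    have h3 : (B : ℝ) ≤ (e : ℝ) * q ρ := by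
      have hB' : (B : ℝ) ≤ (e : ℝ) * (tlowerI S h Q : ℤ) / S := by rw [le_div_iff₀ hSr]; exact hBR
      have : (e : ℝ) * (tlowerI S h Q : ℤ) / S ≤ (e : ℝ) * q ρ := by
        rw [div_le_iff₀ hSr]
        have he0 : (0 : ℝ) ≤ e := by positivity
        nlinarith
      linarith
    have h4 : (e : ℝ) * q ρ ≤ (e : ℝ) * (Real.sqrt (g ρ) + q ρ) := by
      have he0 : (0 : ℝ) ≤ e := by positivity
      nlinarith [Real.sqrt_nonneg (g ρ)]
    linarith
  obtain ⟨bs, hbs, eb⟩ := exists_widen0 has (δ := Real.sqrt (g ρ) - q ρ) (e := e) hδ ρ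
  exact ⟨bs, hbs, by rw [eb, ← eq]; ring⟩

end PolyMP

end Literature.Analysis.ValidatedNumerics
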